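/-
Copyright (c) 2026 the pub-hodgecm-mathlib formalisation cell (harness21).  Prover seat hodgecm-mathlib-K2E3-p12 (g5) (E3 §L lead on loan to E1 by the CHAIR WORD
«β → E1» 2026-09-04T06:25Z), Track B ∕ K2-LIT, h413 = `stmt-HodgeConjecture-24833`, line `K2_E1_TraceFormulaBeta`, campaign «EIS-RANK-ONE» rung R6h;
DEAL (R6h-b)_two of the dealer K2E1-plan (g4) 2026-09-04T06:36:29Z ∕ RULING «ONE LETTER» 06:40:00Z: THE `N = 2` JUNCTION — pole control of the rank-one intertwining
bracket of `U(1,1)` over the CM pair from the DIAGONAL Maass–Selberg relation (★ p857971) through the extraction letter (★ p857990).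
-/
import Summits.HodgeConjecture.HodgeConjecture.Theorems.K2E1MaassSelbergDiagonalCMTwo    -- ★ p857971 (K2E1-p09 g5): the DIAGONAL norm formula at `N = 2` (hypothesis-first on `R`)
import Summits.HodgeConjecture.HodgeConjecture.Theorems.K2E1MaassSelbergPoleControl      -- ★ p857990 (this seat): the (a,b,c)-extraction letter + (a1)(a2)(a3)
import Summits.HodgeConjecture.HodgeConjecture.Theorems.K2E1TruncatedEisensteinContinuousCMTwo  -- ★ p857987 (K2E1-p09 g5): `hcont` discharged at `N = 2` (ED. 2)
import HarnessLib

/-!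
# K2·E1 — `K2E1MaassSelbergPoleControlCMTwo`: POLE CONTROL OF THE INTERTWINING BRACKET OF `U(1,1)` OVER THE CM PAIR FROM THE DIAGONAL MAASS–SELBERG RELATION
# (campaign «EIS-RANK-ONE», rung R6h-b, `N = 2` junction; `2ρ_H = 1`, `x = Re z − ½`, `y = Im z`)

Track B ∕ K2-LIT, crux h413 = `stmt-HodgeConjecture-24833`, route of record `HCCMUnconditional`; cell `hodgecm-mathlib`, squad K2, ENGINE E1.  Prover seat
`hodgecm-mathlib-K2E3-p12` (g5) on loan; DEAL (R6h-b)_two of the dealer K2E1-plan (g4).  THEOREMS ONLY (no `def`, no `instance`, no notation, no named-fact hypothesis,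
no `sorry`); lane `--supports stmt-HodgeConjecture-24833 --as helper` (count-neutral).  Closes no socket.

THE MATHEMATICS [MoeglinWaldspurger1995, IV.2.3, IV.3.12 (a); Arthur1980TraceFormulaII, §4; Garrett2018, §1.12, §11.3].  HYPOTHESIS-FIRST exactly as ★ p857971: for a flat
section `φ` of `U(J₂)` over the CM pair `(L⁺, L, c)`, `Re z > 1`, `Im z ≠ 0`, `T ≥ 1`, the relation of record on the sub-tube `1 < Re z′ < Re z` (★ `K2E1MaassSelbergUTwo` ∕
★ p857851 `maassSelberg_truncation_pair_two` at `φ′ = φ`) with its right-hand side in the FOUR-BRACKET SHAPE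
`R(z′) = c_μ·(K·((T^{s₁}∕s₁)·B₁ + (T^{s₂}∕s₂)·B₂ − (T^{−s₂}∕s₂)·B₃ − (T^{−s₁}∕s₁)·B₄))`, `s₁ = z + conj z′ − 1`, `s₂ = z − conj z′`, the brackets `Bᵢ = [Ξᵢ]` being
complex constants with `B₁ = a > 0`, `B₄ = b ≥ 0` real, `B₃ = conj B₂` and `‖B₂‖² ≤ a·b` (the Cauchy–Schwarz of the `K_U`∕idele-class brackets at `φ′ = φ` — NAMED `hW`,
brick (R6h-c) of the dealer's queue).  THEN, with the named inputs of ★ p857971 (`hdec` z′-uniform, `hcont`):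
* §1 `continuousWithinAt_fourTerm_two` — the explicit `R` is continuous at `z′ = z` inside the sub-tube (`z + conj z − 1 = 2x ≠ 0`, `z − conj z = 2iy ≠ 0`; `cpow` continuous
  in the exponent for the positive base `T`) — the `hR` binder of ★ p857971 DISCHARGED for the relation of record;
* §2 **`poleControl_flatSectionU_cm_two`** — THE JUNCTION: (a1) `√b ≤ x·T^{2x}·√a∕|y| + √(x²·T^{4x}·a∕y² + a·T^{4x})`, (a2) the uniform bound on boxes
  `x ∈ [x₁,x₂]`, `|y| ≥ η`, (a3) `b ≤ C(a,T,x)∕y²` for `0 < |y| ≤ 1` — i.e. «the intertwined bracket `‖(M(z)φ)~‖²`-term `b` has no pole off the real axis and order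
  ≤ 1 on vertical approach» on the convergence range `Re z > 1` [MoeglinWaldspurger1995, IV.3.12 (a)] (★ p857971 gives `‖Λ^T E(φ,z)‖²_X = R(z)`; ★ p857990
  `poleControl_of_fourTerm` extracts, with `Q = ∫_X ‖Λ^T E‖² ≥ 0`, `x = Re z − ½`, `y = Im z`).
ED. 2 (ruling «VAC-B» 06:47:30Z): §2's `hrel` with CONSTANT brackets on the open sub-tube is true-but-not-instantiable; §3 adds the JUNCTION OF RECORD
`poleControl_flatSectionU_cm_two_of_R` in the `R ∕ hR ∕ hrel ∕ hRz` shape of ★ p858014 (+ `hcont` discharged by ★ p857987, + `continuousWithinAt_fourTerm_two'` for `z′`-dependent brackets).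
SAT-WITNESS (ruling «VAC-U» (3)): structural binders as in ★ p857971 (Haar `ν` + `ν`-fundamental domain ★ `exists_isFundamentalDomain_two`, finite `μ`, `V := univ`);
the bracket binders are independently satisfiable (`B₁ = 1, B₂ = B₃ = 0, B₄ = 0, cμ = K = 1`); no subgroup is quantified.
HONEST LABEL: HC_CM is proved only modulo the 7 printed citations (2 remaining named inputs: hLiu418 = `stmt-HodgeConjecture-24832`, h413 = `stmt-HodgeConjecture-24833`)
until rung 0 closes; this file asserts no named fact and closes no socket.
References: [MoeglinWaldspurger1995] IV.2.3, IV.3.12 · [Arthur1980TraceFormulaII] §4 · [Garrett2018] §1.12, §11.3.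
-/

set_option autoImplicit false
-- the mandated namespace repeats the single-problem summit's segment (`HodgeConjecture.HodgeConjecture`)
set_option linter.dupNamespace false

noncomputable section

open MeasureTheory Measure NumberField IsDedekindDomain Set Filter Topology MulAction
open scoped ENNReal NNReal ComplexConjugate
open Literature.NumberTheory.Automorphic Literature.NumberTheory.Automorphic.UnitaryGroup AdelicGroupData
open Summit.HodgeConjecture.HodgeConjecture.Cruxes.H413.K2E1BorelEisensteinU
open Summit.HodgeConjecture.HodgeConjecture.Cruxes.H413.K2E1TruncatedEisensteinL2
open Summit.HodgeConjecture.HodgeConjecture.Cruxes.H413.K2E1MaassSelbergDiagonalCMTwo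
open Summit.HodgeConjecture.HodgeConjecture.Cruxes.H413.K2E1MaassSelbergPoleControl
open Summit.HodgeConjecture.HodgeConjecture.Cruxes.H413.K2E1TruncatedEisensteinContinuousCMTwo

namespace Summit.HodgeConjecture.HodgeConjecture.Cruxes.H413.K2E1MaassSelbergPoleControlCMTwo

/-! ## §1  The explicit right-hand side is continuous at the diagonal -/

/-- `z + conj z − 1 = 2·(Re z − ½)` and `z − conj z = (2·Im z)·i`. [folklore] -/
theorem add_conj_sub_one_eq (z : ℂ) : z + conj z - 1 = ((2 * (z.re - 1 / 2) : ℝ) : ℂ) ∧ z - conj z = ((2 * z.im : ℝ) : ℂ) * Complex.I := by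
  refine ⟨?_, Complex.sub_conj z⟩
  rw [Complex.add_conj]; push_cast; ring

/-- **The four-bracket right-hand side `R(z′)` is continuous at `z′ = z` within the sub-tube** (`Re z > 1`, `Im z ≠ 0`, `T > 0`): the exponents `z + conj z′ − 1`,
`±(z − conj z′)` move continuously, the base `T > 0` makes `w ↦ T^w` continuous, and the two denominators are `2x ≠ 0`, `2iy ≠ 0` at `z′ = z`.
[cite: MoeglinWaldspurger1995, IV.2.3] -/
theorem continuousWithinAt_fourTerm_two {T : ℝ} (hT : 0 < T) {z : ℂ} (hz : 1 < z.re) (hy : z.im ≠ 0) (cμ K : ℝ) (B₁ B₂ B₃ B₄ : ℂ) (S : Set ℂ) :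
    ContinuousWithinAt (fun z' : ℂ => (cμ : ℂ) * ((K : ℂ) *
        ((((T : ℝ) : ℂ) ^ (z + conj z' - 1) / (z + conj z' - 1)) * B₁ + (((T : ℝ) : ℂ) ^ (z - conj z') / (z - conj z')) * B₂
          - (((T : ℝ) : ℂ) ^ (-(z - conj z')) / (z - conj z')) * B₃ - (((T : ℝ) : ℂ) ^ (-(z + conj z' - 1)) / (z + conj z' - 1)) * B₄))) S z := by
  have hTc : ((T : ℝ) : ℂ) ≠ 0 := by exact_mod_cast hT.ne'
  have h1 : z + conj z - 1 ≠ 0 := by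
    rw [(add_conj_sub_one_eq z).1]; exact_mod_cast (by linarith : (2 * (z.re - 1 / 2) : ℝ) ≠ 0)
  have h2 : z - conj z ≠ 0 := by
    rw [(add_conj_sub_one_eq z).2]
    exact mul_ne_zero (by exact_mod_cast (mul_ne_zero two_ne_zero hy)) Complex.I_ne_zero
  have hs₁ : Continuous fun z' : ℂ => z + conj z' - 1 := (continuous_const.add Complex.continuous_conj).sub continuous_const
  have hs₂ : Continuous fun z' : ℂ => z - conj z' := continuous_const.sub Complex.continuous_conj
  have hpow : ∀ {f : ℂ → ℂ}, Continuous f → ContinuousAt (fun z' => ((T : ℝ) : ℂ) ^ f z') z :=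
    fun hf => (continuousAt_const_cpow hTc).comp hf.continuousAt
  refine ContinuousAt.continuousWithinAt ?_
  refine continuousAt_const.mul (continuousAt_const.mul ?_)
  refine ((ContinuousAt.sub (ContinuousAt.add ?_ ?_) ?_).sub ?_)
  · exact ((hpow hs₁).div hs₁.continuousAt h1).mul continuousAt_const
  · exact ((hpow hs₂).div hs₂.continuousAt h2).mul continuousAt_const
  · exact ((hpow hs₂.neg).div hs₂.continuousAt h2).mul continuousAt_const
  · exact ((hpow hs₁.neg).div hs₁.continuousAt h1).mul continuousAt_const

/-! ## §2  The junction -/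

section Junction

variable (L : Type) [Field L] [NumberField L] [IsCMField L]
variable [MeasurableSpace (quasiSplit (↥(maximalRealSubfield L)) L (IsCMField.complexConj L) 2).Adelic] [BorelSpace (quasiSplit (↥(maximalRealSubfield L)) L (IsCMField.complexConj L) 2).Adelic]
  [MeasurableSpace (adelicUnipotent (↥(maximalRealSubfield L)) L (IsCMField.complexConj L) 2)] [BorelSpace (adelicUnipotent (↥(maximalRealSubfield L)) L (IsCMField.complexConj L) 2)]

/-- **POLE CONTROL OF THE INTERTWINING BRACKET OF `U(1,1)` OVER THE CM PAIR** (rank-one, `Re z > 1`, `Im z ≠ 0`, `T ≥ 1`), HYPOTHESIS-FIRST as ★ p857971: if the relation of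
record holds on the sub-tube `1 < Re z′ < Re z` with the FOUR-BRACKET right-hand side (`c_μ, K > 0`; brackets `B₁ = a > 0`, `B₄ = b ≥ 0` real, `B₃ = conj B₂`,
`‖B₂‖² ≤ a·b` — the Cauchy–Schwarz `hW` NAMED, brick (R6h-c)), then with `x = Re z − ½`, `y = Im z`:
(a1) `√b ≤ x·T^{2x}·√a∕|y| + √(x²·T^{4x}·a∕y² + a·T^{4x})`, (a2) `b` is uniformly bounded on `x ∈ [x₁,x₂]`, `|y| ≥ η`, (a3) `b ≤ C∕y²` for `|y| ≤ 1`.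
(★ p857971 diagonal norm formula — its `hR` discharged by §1 — then ★ p857990 `poleControl_of_fourTerm` with `Q = ∫_X ‖Λ^T E(φ,z)‖² ≥ 0`.)
[cite: MoeglinWaldspurger1995, IV.3.12 (a)] [cite: Arthur1980TraceFormulaII, §4] [cite: Garrett2018, §1.12] -/
theorem poleControl_flatSectionU_cm_two
    (ν : Measure (adelicUnipotent (↥(maximalRealSubfield L)) L (IsCMField.complexConj L) 2)) [ν.IsHaarMeasure]
    {𝓕 : Set (adelicUnipotent (↥(maximalRealSubfield L)) L (IsCMField.complexConj L) 2)}
    (h𝓕 : IsFundamentalDomain (rationalUnipotent (↥(maximalRealSubfield L)) L (IsCMField.complexConj L) 2) 𝓕 ν) {T : ℝ≥0} (hT : 1 ≤ T)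
    {z : ℂ} (hz : 1 < z.re)
    {φ : (quasiSplit (↥(maximalRealSubfield L)) L (IsCMField.complexConj L) 2).Adelic → ℂ} (hφc : Continuous φ) {M : ℝ} (hφM : ∀ x, ‖φ x‖ ≤ M)
    (hφB : ∀ b ∈ borelU ((IsCMField.complexConj L : L ≃ₐ[↥(maximalRealSubfield L)] L) : L →+* L) ((StdForm.antidiagonal 2).over L), ∀ x : (quasiSplit (↥(maximalRealSubfield L)) L (IsCMField.complexConj L) 2).Adelic, φ ((quasiSplit (↥(maximalRealSubfield L)) L (IsCMField.complexConj L) 2).toAdelic b * x) = φ x)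
    (μ : Measure (quasiSplit (↥(maximalRealSubfield L)) L (IsCMField.complexConj L) 2).automorphicQuotient) [IsFiniteMeasure μ]
    -- the ONE analytic named input of ★ (R6g-a)_two: the decay, z′-uniform on a neighbourhood of `z`
    {V : Set ℂ} (hV : V ∈ 𝓝 z) {M₁ : ℝ}
    (hdec : ∀ z' ∈ V, ∀ g : (quasiSplit (↥(maximalRealSubfield L)) L (IsCMField.complexConj L) 2).Adelic, T < borelHeight g →
      ‖eisensteinSeriesU (flatSectionU φ z') g - borelConstantTerm ν 𝓕 (eisensteinSeriesU (flatSectionU φ z')) g‖ ≤ M₁)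
    -- NAMED: pointwise continuity of the truncation in `z′` from inside the sub-tube (brick (R6g-c)_two)
    (hcont : ∀ g : (quasiSplit (↥(maximalRealSubfield L)) L (IsCMField.complexConj L) 2).Adelic,
      ContinuousWithinAt (fun z' : ℂ => truncation ν 𝓕 T (eisensteinSeriesU (flatSectionU φ z')) g) {z' : ℂ | 1 < z'.re ∧ z'.re < z.re} z)
    -- the relation of record on the sub-tube, FOUR-BRACKET SHAPE (★ `K2E1MaassSelbergUTwo` ∕ ★ p857851 at `φ′ = φ`)
    {cμ K a b : ℝ} (hcμ : 0 < cμ) (hK : 0 < K) {B₁ B₂ B₃ B₄ : ℂ} (hB₁ : B₁ = (a : ℂ)) (hB₃ : B₃ = conj B₂) (hB₄ : B₄ = (b : ℂ))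
    (ha : 0 < a) (hb : 0 ≤ b) (hW : ‖B₂‖ ^ 2 ≤ a * b) (hy : z.im ≠ 0)
    (hrel : ∀ z' : ℂ, 1 < z'.re → z'.re < z.re →
      ∫ x, (quasiSplit (↥(maximalRealSubfield L)) L (IsCMField.complexConj L) 2).quotFun (truncation ν 𝓕 T (eisensteinSeriesU (flatSectionU φ z))) x *
          conj ((quasiSplit (↥(maximalRealSubfield L)) L (IsCMField.complexConj L) 2).quotFun (truncation ν 𝓕 T (eisensteinSeriesU (flatSectionU φ z'))) x) ∂μ =
        (cμ : ℂ) * ((K : ℂ) *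
        ((((T : ℝ) : ℂ) ^ (z + conj z' - 1) / (z + conj z' - 1)) * B₁ + (((T : ℝ) : ℂ) ^ (z - conj z') / (z - conj z')) * B₂
          - (((T : ℝ) : ℂ) ^ (-(z - conj z')) / (z - conj z')) * B₃ - (((T : ℝ) : ℂ) ^ (-(z + conj z' - 1)) / (z + conj z' - 1)) * B₄))) :
    Real.sqrt b ≤ (z.re - 1 / 2) * (T : ℝ) ^ (2 * (z.re - 1 / 2)) * Real.sqrt a / |z.im| +
        Real.sqrt ((z.re - 1 / 2) ^ 2 * (T : ℝ) ^ (4 * (z.re - 1 / 2)) * a / z.im ^ 2 + a * (T : ℝ) ^ (4 * (z.re - 1 / 2))) ∧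
      (∀ {x₁ x₂ η : ℝ}, 0 < x₁ → (z.re - 1 / 2) ∈ Set.Icc x₁ x₂ → 0 < η → η ≤ |z.im| →
        b ≤ (x₂ * (T : ℝ) ^ (2 * x₂) * Real.sqrt a / η + Real.sqrt (x₂ ^ 2 * (T : ℝ) ^ (4 * x₂) * a / η ^ 2 + a * (T : ℝ) ^ (4 * x₂))) ^ 2) ∧
      (|z.im| ≤ 1 → b ≤ ((z.re - 1 / 2) * (T : ℝ) ^ (2 * (z.re - 1 / 2)) * Real.sqrt a +
        Real.sqrt ((z.re - 1 / 2) ^ 2 * (T : ℝ) ^ (4 * (z.re - 1 / 2)) * a + a * (T : ℝ) ^ (4 * (z.re - 1 / 2)))) ^ 2 / z.im ^ 2) := by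
  have hT1 : (1 : ℝ) ≤ (T : ℝ) := by exact_mod_cast hT
  have hT0 : (0 : ℝ) < (T : ℝ) := lt_of_lt_of_le one_pos hT1
  have hx : 0 < z.re - 1 / 2 := by linarith
  -- ★ p857971: the diagonal norm formula with the explicit `R` (its continuity = §1)
  have hdiag := maassSelberg_diagonal_flatSectionU_cm_two L ν h𝓕 hT hz hφc hφM hφB μ hV hdec hcont
    (continuousWithinAt_fourTerm_two hT0 hz hy cμ K B₁ B₂ B₃ B₄ _) hrel
  -- the extraction letter ★ p857990
  have hQ : 0 ≤ ∫ x, ‖(quasiSplit (↥(maximalRealSubfield L)) L (IsCMField.complexConj L) 2).quotFun (truncation ν 𝓕 T (eisensteinSeriesU (flatSectionU φ z))) x‖ ^ 2 ∂μ :=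
    integral_nonneg fun _ => by positivity
  obtain ⟨hs₁, hs₂⟩ := add_conj_sub_one_eq z
  exact poleControl_of_fourTerm hcμ hK hT1 hx hy hQ ha hb hW hs₁ hs₂ hB₁ hB₃ hB₄ hdiag

end Junction


/-! ## §3  ED. 2 — THE JUNCTION OF RECORD (ruling «VAC-B» 2026-09-04T06:47:30Z repaired)

The `hrel` binder of §2 quantifies over the open sub-tube with CONSTANT brackets, whereas in the relation of record the brackets `[Ξ₂]`, `[Ξ₄]` depend on `z′`
(they carry the intertwined coefficient `c_φ(z′,k)`); §2 is therefore true but not instantiable from the Eisenstein data («VAC-B», left in place).  The shape of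
record (★ p858014 §3) carries an ARBITRARY right side `R` with its continuity `hR`, the relation `hrel : ⟪Λ^T E(z), Λ^T E(z′)⟫ = R z′`, and the four-term
VALUE AT THE POINT `hRz : R z = cμ·(K·(…))`.  ED. 2 adds (a) the continuity of the explicit `R` when the `z′`-dependent brackets `B₂ B₄ : ℂ → ℂ` are continuous
from inside the tube (the named inputs «(R6j) bracket continuity», K2E4-p10 (g4)), (b) the `N = 2` norm formula with `hcont` DISCHARGED (★ p857987), and
(c) the junction of record `poleControl_flatSectionU_cm_two_of_R`. -/

/-- **Continuity of the explicit four-bracket right side with `z′`-DEPENDENT brackets**: if `B₂ B₄ : ℂ → ℂ` are continuous at `z` from inside `S` (constants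
`B₁ B₃`), then so is `z′ ↦ cμ·(K·(T^{z+conj z′−1}∕(z+conj z′−1)·B₁ + T^{z−conj z′}∕(z−conj z′)·B₂ z′ − T^{−(z−conj z′)}∕(z−conj z′)·B₃ − T^{−(z+conj z′−1)}∕(z+conj z′−1)·B₄ z′))`
(`Re z > 1`, `Im z ≠ 0`, `T > 0`). [cite: MoeglinWaldspurger1995, IV.2.3] -/
theorem continuousWithinAt_fourTerm_two' {T : ℝ} (hT : 0 < T) {z : ℂ} (hz : 1 < z.re) (hy : z.im ≠ 0) (cμ K : ℝ) (B₁ B₃ : ℂ) {B₂ B₄ : ℂ → ℂ} {S : Set ℂ}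
    (hB₂ : ContinuousWithinAt B₂ S z) (hB₄ : ContinuousWithinAt B₄ S z) :
    ContinuousWithinAt (fun z' : ℂ => (cμ : ℂ) * ((K : ℂ) *
        ((((T : ℝ) : ℂ) ^ (z + conj z' - 1) / (z + conj z' - 1)) * B₁ + (((T : ℝ) : ℂ) ^ (z - conj z') / (z - conj z')) * B₂ z'
          - (((T : ℝ) : ℂ) ^ (-(z - conj z')) / (z - conj z')) * B₃ - (((T : ℝ) : ℂ) ^ (-(z + conj z' - 1)) / (z + conj z' - 1)) * B₄ z'))) S z := by
  have hTc : ((T : ℝ) : ℂ) ≠ 0 := by exact_mod_cast hT.ne'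
  have h1 : z + conj z - 1 ≠ 0 := by
    rw [(add_conj_sub_one_eq z).1]; exact_mod_cast (by linarith : (2 * (z.re - 1 / 2) : ℝ) ≠ 0)
  have h2 : z - conj z ≠ 0 := by
    rw [(add_conj_sub_one_eq z).2]
    exact mul_ne_zero (by exact_mod_cast (mul_ne_zero two_ne_zero hy)) Complex.I_ne_zero
  have hs₁ : Continuous fun z' : ℂ => z + conj z' - 1 := (continuous_const.add Complex.continuous_conj).sub continuous_const
  have hs₂ : Continuous fun z' : ℂ => z - conj z' := continuous_const.sub Complex.continuous_conj
  have hpow : ∀ {f : ℂ → ℂ}, Continuous f → ContinuousWithinAt (fun z' => ((T : ℝ) : ℂ) ^ f z') S z :=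
    fun hf => ((continuousAt_const_cpow hTc).comp hf.continuousAt).continuousWithinAt
  refine continuousWithinAt_const.mul (continuousWithinAt_const.mul ?_)
  refine ((ContinuousWithinAt.sub (ContinuousWithinAt.add ?_ ?_) ?_).sub ?_)
  · exact ((hpow hs₁).div hs₁.continuousWithinAt h1).mul continuousWithinAt_const
  · exact ((hpow hs₂).div hs₂.continuousWithinAt h2).mul hB₂
  · exact ((hpow hs₂.neg).div hs₂.continuousWithinAt h2).mul continuousWithinAt_const
  · exact ((hpow hs₁.neg).div hs₁.continuousWithinAt h1).mul hB₄

section JunctionOfRecord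

variable (L : Type) [Field L] [NumberField L] [IsCMField L]
variable [MeasurableSpace (quasiSplit (↥(maximalRealSubfield L)) L (IsCMField.complexConj L) 2).Adelic] [BorelSpace (quasiSplit (↥(maximalRealSubfield L)) L (IsCMField.complexConj L) 2).Adelic]
  [MeasurableSpace (adelicUnipotent (↥(maximalRealSubfield L)) L (IsCMField.complexConj L) 2)] [BorelSpace (adelicUnipotent (↥(maximalRealSubfield L)) L (IsCMField.complexConj L) 2)]

/-- **THE `N = 2` NORM FORMULA WITH `hcont` DISCHARGED**: under the structural hypotheses of ★ p857971 plus `ν 𝓕 ≠ ∞`, for an arbitrary right side `R` continuous at `z`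
from inside the sub-tube and satisfying the relation of record there, `‖Λ^T E(φ,z)‖²_μ = R z` (★ p857971 with ★ p857987 `continuousWithinAt_…_subtube_cm_two`).
[cite: MoeglinWaldspurger1995, IV.2.3] [cite: Arthur1980TraceFormulaII, §4] -/
theorem integral_normSq_truncation_eq_cm_two
    (ν : Measure (adelicUnipotent (↥(maximalRealSubfield L)) L (IsCMField.complexConj L) 2)) [ν.IsHaarMeasure]
    {𝓕 : Set (adelicUnipotent (↥(maximalRealSubfield L)) L (IsCMField.complexConj L) 2)}
    (h𝓕 : IsFundamentalDomain (rationalUnipotent (↥(maximalRealSubfield L)) L (IsCMField.complexConj L) 2) 𝓕 ν) (h𝓕top : ν 𝓕 ≠ ∞) {T : ℝ≥0} (hT : 1 ≤ T)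
    {z : ℂ} (hz : 1 < z.re)
    {φ : (quasiSplit (↥(maximalRealSubfield L)) L (IsCMField.complexConj L) 2).Adelic → ℂ} (hφc : Continuous φ) {M : ℝ} (hφM : ∀ x, ‖φ x‖ ≤ M)
    (hφB : ∀ b ∈ borelU ((IsCMField.complexConj L : L ≃ₐ[↥(maximalRealSubfield L)] L) : L →+* L) ((StdForm.antidiagonal 2).over L), ∀ x : (quasiSplit (↥(maximalRealSubfield L)) L (IsCMField.complexConj L) 2).Adelic, φ ((quasiSplit (↥(maximalRealSubfield L)) L (IsCMField.complexConj L) 2).toAdelic b * x) = φ x)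
    (μ : Measure (quasiSplit (↥(maximalRealSubfield L)) L (IsCMField.complexConj L) 2).automorphicQuotient) [IsFiniteMeasure μ]
    {V : Set ℂ} (hV : V ∈ 𝓝 z) {M₁ : ℝ}
    (hdec : ∀ z' ∈ V, ∀ g : (quasiSplit (↥(maximalRealSubfield L)) L (IsCMField.complexConj L) 2).Adelic, T < borelHeight g →
      ‖eisensteinSeriesU (flatSectionU φ z') g - borelConstantTerm ν 𝓕 (eisensteinSeriesU (flatSectionU φ z')) g‖ ≤ M₁)
    {R : ℂ → ℂ} (hR : ContinuousWithinAt R {z' : ℂ | 1 < z'.re ∧ z'.re < z.re} z)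
    (hrel : ∀ z' : ℂ, 1 < z'.re → z'.re < z.re →
      ∫ x, (quasiSplit (↥(maximalRealSubfield L)) L (IsCMField.complexConj L) 2).quotFun (truncation ν 𝓕 T (eisensteinSeriesU (flatSectionU φ z))) x *
          conj ((quasiSplit (↥(maximalRealSubfield L)) L (IsCMField.complexConj L) 2).quotFun (truncation ν 𝓕 T (eisensteinSeriesU (flatSectionU φ z'))) x) ∂μ = R z') :
    ((∫ x, ‖(quasiSplit (↥(maximalRealSubfield L)) L (IsCMField.complexConj L) 2).quotFun (truncation ν 𝓕 T (eisensteinSeriesU (flatSectionU φ z))) x‖ ^ 2 ∂μ : ℝ) : ℂ) = R z :=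
  maassSelberg_diagonal_flatSectionU_cm_two L ν h𝓕 hT hz hφc hφM hφB μ hV hdec
    (fun g => continuousWithinAt_truncation_eisensteinSeriesU_flatSectionU_subtube_cm_two L ν h𝓕top hT hφc hφM hφB hz g) hR hrel

/-- **POLE CONTROL OF THE INTERTWINING BRACKET OF `U(1,1)` OVER THE CM PAIR — JUNCTION OF RECORD** (shape of ★ p858014 §3; «VAC-B» repaired): for an ARBITRARY right side
`R` (continuity `hR` — e.g. §3 `continuousWithinAt_fourTerm_two'` from the bracket continuities; relation `hrel` on the sub-tube `1 < Re z′ < Re z`) whose VALUE AT `z`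
has the four-term shape `R z = cμ·(K·(T^{z+conj z−1}∕(…)·B₁ + T^{z−conj z}∕(…)·W − T^{−(z−conj z)}∕(…)·B₃ − T^{−(z+conj z−1)}∕(…)·B₄))` with `B₁ = a > 0`, `B₃ = conj W`,
`B₄ = b ≥ 0`, `‖W‖² ≤ a·b` (the Cauchy–Schwarz `hW` NAMED, ★ p858065) and `Im z ≠ 0`: with `x = Re z − ½`, `y = Im z`, (a1) `√b ≤ x·T^{2x}·√a∕|y| + √(x²T^{4x}a∕y² + aT^{4x})`,
(a2) the uniform box bound, (a3) `b ≤ C∕y²` for `|y| ≤ 1` (norm formula above + ★ p857990 `poleControl_of_fourTerm`).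
[cite: MoeglinWaldspurger1995, IV.3.12 (a)] [cite: Arthur1980TraceFormulaII, §4] [cite: Garrett2018, §1.12] -/
theorem poleControl_flatSectionU_cm_two_of_R
    (ν : Measure (adelicUnipotent (↥(maximalRealSubfield L)) L (IsCMField.complexConj L) 2)) [ν.IsHaarMeasure]
    {𝓕 : Set (adelicUnipotent (↥(maximalRealSubfield L)) L (IsCMField.complexConj L) 2)}
    (h𝓕 : IsFundamentalDomain (rationalUnipotent (↥(maximalRealSubfield L)) L (IsCMField.complexConj L) 2) 𝓕 ν) (h𝓕top : ν 𝓕 ≠ ∞) {T : ℝ≥0} (hT : 1 ≤ T)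
    {z : ℂ} (hz : 1 < z.re)
    {φ : (quasiSplit (↥(maximalRealSubfield L)) L (IsCMField.complexConj L) 2).Adelic → ℂ} (hφc : Continuous φ) {M : ℝ} (hφM : ∀ x, ‖φ x‖ ≤ M)
    (hφB : ∀ b ∈ borelU ((IsCMField.complexConj L : L ≃ₐ[↥(maximalRealSubfield L)] L) : L →+* L) ((StdForm.antidiagonal 2).over L), ∀ x : (quasiSplit (↥(maximalRealSubfield L)) L (IsCMField.complexConj L) 2).Adelic, φ ((quasiSplit (↥(maximalRealSubfield L)) L (IsCMField.complexConj L) 2).toAdelic b * x) = φ x)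
    (μ : Measure (quasiSplit (↥(maximalRealSubfield L)) L (IsCMField.complexConj L) 2).automorphicQuotient) [IsFiniteMeasure μ]
    {V : Set ℂ} (hV : V ∈ 𝓝 z) {M₁ : ℝ}
    (hdec : ∀ z' ∈ V, ∀ g : (quasiSplit (↥(maximalRealSubfield L)) L (IsCMField.complexConj L) 2).Adelic, T < borelHeight g →
      ‖eisensteinSeriesU (flatSectionU φ z') g - borelConstantTerm ν 𝓕 (eisensteinSeriesU (flatSectionU φ z')) g‖ ≤ M₁)
    {R : ℂ → ℂ} (hR : ContinuousWithinAt R {z' : ℂ | 1 < z'.re ∧ z'.re < z.re} z)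
    (hrel : ∀ z' : ℂ, 1 < z'.re → z'.re < z.re →
      ∫ x, (quasiSplit (↥(maximalRealSubfield L)) L (IsCMField.complexConj L) 2).quotFun (truncation ν 𝓕 T (eisensteinSeriesU (flatSectionU φ z))) x *
          conj ((quasiSplit (↥(maximalRealSubfield L)) L (IsCMField.complexConj L) 2).quotFun (truncation ν 𝓕 T (eisensteinSeriesU (flatSectionU φ z'))) x) ∂μ = R z')
    -- the diagonal SHAPE of the right side at `z′ = z` and the bracket facts
    {cμ K a b : ℝ} (hcμ : 0 < cμ) (hK : 0 < K) (ha : 0 < a) (hb : 0 ≤ b) {W B₁ B₃ B₄ : ℂ}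
    (hB₁ : B₁ = (a : ℂ)) (hB₃ : B₃ = conj W) (hB₄ : B₄ = (b : ℂ)) (hW : ‖W‖ ^ 2 ≤ a * b) (hy : z.im ≠ 0)
    (hRz : R z = (cμ : ℂ) * ((K : ℂ) *
      ((((T : ℝ) : ℂ) ^ (z + conj z - 1) / (z + conj z - 1)) * B₁ + (((T : ℝ) : ℂ) ^ (z - conj z) / (z - conj z)) * W
        - (((T : ℝ) : ℂ) ^ (-(z - conj z)) / (z - conj z)) * B₃ - (((T : ℝ) : ℂ) ^ (-(z + conj z - 1)) / (z + conj z - 1)) * B₄))) :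
    Real.sqrt b ≤ (z.re - 1 / 2) * (T : ℝ) ^ (2 * (z.re - 1 / 2)) * Real.sqrt a / |z.im| +
        Real.sqrt ((z.re - 1 / 2) ^ 2 * (T : ℝ) ^ (4 * (z.re - 1 / 2)) * a / z.im ^ 2 + a * (T : ℝ) ^ (4 * (z.re - 1 / 2))) ∧
      (∀ {x₁ x₂ η : ℝ}, 0 < x₁ → (z.re - 1 / 2) ∈ Set.Icc x₁ x₂ → 0 < η → η ≤ |z.im| →
        b ≤ (x₂ * (T : ℝ) ^ (2 * x₂) * Real.sqrt a / η + Real.sqrt (x₂ ^ 2 * (T : ℝ) ^ (4 * x₂) * a / η ^ 2 + a * (T : ℝ) ^ (4 * x₂))) ^ 2) ∧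
      (|z.im| ≤ 1 → b ≤ ((z.re - 1 / 2) * (T : ℝ) ^ (2 * (z.re - 1 / 2)) * Real.sqrt a +
        Real.sqrt ((z.re - 1 / 2) ^ 2 * (T : ℝ) ^ (4 * (z.re - 1 / 2)) * a + a * (T : ℝ) ^ (4 * (z.re - 1 / 2)))) ^ 2 / z.im ^ 2) := by
  have hT1 : (1 : ℝ) ≤ (T : ℝ) := by exact_mod_cast hT
  have hx : 0 < z.re - 1 / 2 := by linarith
  have hNeq := integral_normSq_truncation_eq_cm_two L ν h𝓕 h𝓕top hT hz hφc hφM hφB μ hV hdec hR hrel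
  rw [hRz] at hNeq
  have hQ : 0 ≤ ∫ x, ‖(quasiSplit (↥(maximalRealSubfield L)) L (IsCMField.complexConj L) 2).quotFun (truncation ν 𝓕 T (eisensteinSeriesU (flatSectionU φ z))) x‖ ^ 2 ∂μ :=
    integral_nonneg fun _ => by positivity
  obtain ⟨hs₁, hs₂⟩ := add_conj_sub_one_eq z
  exact poleControl_of_fourTerm hcμ hK hT1 hx hy hQ ha hb hW hs₁ hs₂ hB₁ hB₃ hB₄ hNeq

end JunctionOfRecord

end Summit.HodgeConjecture.HodgeConjecture.Cruxes.H413.K2E1MaassSelbergPoleControlCMTwo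

end
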